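import Literature.GroupTheory.CombinatorialGroupTheory.QuadraticWordsVertices
import Mathlib.GroupTheory.Perm.Cycle.Basic
import Mathlib.GroupTheory.Perm.List
import HarnessLib

/-!
# The vertex map on positions versus the vertex permutation on letters

Topic `Literature/GroupTheory/CombinatorialGroupTheory`.  For a word `w` without repeated letters in
which every letter has its partner (the formal inverse) — e.g. an alternating quadratic word — the
vertices of the surface of `w` (Zieschang–Vogt–Coldewey, LNM 835, §3.1, 3.1.3–3.1.6) can be read
in two equivalent ways:

* on POSITIONS (`QuadraticWordsVertices.lean`): `ρ(k)` = position of the partner of the letter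
  before position `k` (`vertexMap w`, transitivity = `OneVertex w`);
* on LETTERS: `σ(x)` = the letter cyclically after the partner `x̄` of `x` in `w` — in Mathlib terms
  `σ x = w.formPerm x̄` (`List.formPerm` is the cyclic successor permutation of a duplicate-free
  list); for a SYSTEM of faces one takes the product of the faces' `formPerm`s.

Reading a position as the letter it carries, `σ` is the INVERSE of `ρ`: `σ (w[ρ k]) = w[k]`
(`apply_get_vertexMap`).  Hence (`oneVertex_of_sameCycle`): **if all letters of `w` lie in one cycle
of a permutation `σ` of the letters that agrees with `x ↦ w.formPerm x̄` on `w`, then `w` has one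
vertex** (`OneVertex w`).  This is the bridge by which a face-system vertex bookkeeping on letters
(contraction of tree symbols, gluing of faces in the Reidemeister–Schreier computation of
finite-index subgroups of surface groups, ZVC 4.14.22) feeds `OneVertex.nondeg` and the surface
normal form (`QuadraticWordsSurfaceNormalForm.lean`).  Theorems only.

## References

* H. Zieschang, E. Vogt, H.-D. Coldewey, *Surfaces and Planar Discontinuous Groups*, LNM 835,
  Springer 1980, §3.1 (3.1.3–3.1.6). [ZieschangVogtColdewey1980]
-/

namespace Literature.GroupTheory.CombinatorialGroupTheory

open List

variable {ι : Type*} [DecidableEq ι] {w : List (ι × Bool)}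

/-! ### Partner positions carry partner letters -/

/-- **The partner position carries the partner letter**, provided the partner letter occurs.
[cite: ZieschangVogtColdewey1980, 3.1.3] -/
theorem get_partnerPos (hc : ∀ x ∈ w, (x.1, !x.2) ∈ w) (k : Fin w.length) :
    w.get (partnerPos w k) = ((w.get k).1, !(w.get k).2) := by
  have hm : ((w.get k).1, !(w.get k).2) ∈ w := hc _ (get_mem w k)
  have hlt : w.idxOf ((w.get k).1, !(w.get k).2) < w.length := idxOf_lt_length_iff.2 hm
  have e : partnerPos w k = ⟨w.idxOf ((w.get k).1, !(w.get k).2), hlt⟩ :=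
    Fin.ext (by simp only [partnerPos]; exact Nat.mod_eq_of_lt hlt)
  rw [e, idxOf_get hlt]

/-- The partner position map is injective on a duplicate-free word with all partners.
[cite: ZieschangVogtColdewey1980, 3.1.3] -/
theorem partnerPos_injective (hd : w.Nodup) (hc : ∀ x ∈ w, (x.1, !x.2) ∈ w) :
    Function.Injective (partnerPos w) := by
  intro k k' h
  have e := congrArg w.get h
  rw [get_partnerPos hc, get_partnerPos hc, Prod.mk.injEq, Bool.not_inj_iff] at e
  exact nodup_iff_injective_get.1 hd (Prod.ext e.1 e.2)

/-- The successor of the cyclic predecessor is the position itself: `(pred k + 1) mod n = k`.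
[cite: ZieschangVogtColdewey1980, 3.1.3] -/
theorem predPos_val_add_one_mod {n : ℕ} (k : Fin n) : ((predPos k).val + 1) % n = k.val := by
  have hn := k.pos
  have hk := k.isLt
  by_cases h0 : k.val = 0
  · rw [predPos_val_of_eq_zero k h0, Nat.sub_add_cancel hn, Nat.mod_self, h0]
  · rw [predPos_val_of_pos k (Nat.pos_of_ne_zero h0), Nat.sub_add_cancel (Nat.pos_of_ne_zero h0),
      Nat.mod_eq_of_lt hk]

/-- The cyclic predecessor map is injective. [cite: ZieschangVogtColdewey1980, 3.1.3] -/
theorem predPos_injective {n : ℕ} : Function.Injective (predPos (n := n)) := by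
  intro k k' h
  apply Fin.ext
  rw [← predPos_val_add_one_mod k, ← predPos_val_add_one_mod k', h]

/-- The vertex map is injective (hence a permutation of the positions) on a duplicate-free word with
all partners. [cite: ZieschangVogtColdewey1980, 3.1.6] -/
theorem vertexMap_injective (hd : w.Nodup) (hc : ∀ x ∈ w, (x.1, !x.2) ∈ w) :
    Function.Injective (vertexMap w) :=
  fun _ _ h => predPos_injective (partnerPos_injective hd hc h)

/-! ### The letter permutation is the inverse of the position map -/

/-- The cyclic successor of the letter before position `k` is the letter at `k`.
[cite: ZieschangVogtColdewey1980, 3.1.3] -/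
theorem formPerm_get_predPos (hd : w.Nodup) (k : Fin w.length) :
    w.formPerm (w.get (predPos k)) = w.get k := by
  rw [get_eq_getElem, formPerm_apply_getElem w hd, get_eq_getElem]
  congr 1
  exact predPos_val_add_one_mod k

/-- **`σ (w[ρ k]) = w[k]`**: a permutation of the letters agreeing with `x ↦ formPerm w x̄` on `w`
undoes the vertex map read on letters. [cite: ZieschangVogtColdewey1980, 3.1.6] -/
theorem apply_get_vertexMap (hd : w.Nodup) (hc : ∀ x ∈ w, (x.1, !x.2) ∈ w)
    (σ : Equiv.Perm (ι × Bool)) (hσ : ∀ x ∈ w, σ x = w.formPerm (x.1, !x.2)) (k : Fin w.length) :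
    σ (w.get (vertexMap w k)) = w.get k := by
  have hm : w.get (vertexMap w k) ∈ w := get_mem w _
  rw [hσ _ hm]
  simp only [vertexMap, get_partnerPos hc, Bool.not_not, Prod.mk.eta]
  exact formPerm_get_predPos hd k

/-- Iterating: `σ⁻ᵐ (w[k]) = w[ρᵐ k]`. [cite: ZieschangVogtColdewey1980, 3.1.6] -/
theorem inv_pow_apply_get (hd : w.Nodup) (hc : ∀ x ∈ w, (x.1, !x.2) ∈ w)
    (σ : Equiv.Perm (ι × Bool)) (hσ : ∀ x ∈ w, σ x = w.formPerm (x.1, !x.2)) (m : ℕ)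
    (k : Fin w.length) : (σ⁻¹ ^ m) (w.get k) = w.get ((vertexMap w)^[m] k) := by
  induction m generalizing k with
  | zero => rfl
  | succ m ih =>
    rw [pow_succ', Equiv.Perm.mul_apply, ih, Function.iterate_succ_apply', Equiv.Perm.inv_eq_iff_eq]
    exact (apply_get_vertexMap hd hc σ hσ _).symm

/-- **One cycle on letters ⇒ one vertex on positions.**  If `w` has no repeated letter and contains
the partner of each of its letters, and all letters of `w` lie in a single cycle of a permutation `σ`
of the letters that agrees with `x ↦ w.formPerm x̄` on `w`, then `OneVertex w`.
[cite: ZieschangVogtColdewey1980, 3.1.6] -/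
theorem oneVertex_of_sameCycle (hd : w.Nodup) (hc : ∀ x ∈ w, (x.1, !x.2) ∈ w)
    (σ : Equiv.Perm (ι × Bool)) (hσ : ∀ x ∈ w, σ x = w.formPerm (x.1, !x.2))
    (h : ∀ x ∈ w, ∀ y ∈ w, σ.SameCycle x y) : OneVertex w := by
  -- the vertex map as a permutation of the (finitely many) positions
  have hbij : Function.Bijective (vertexMap w) :=
    Finite.injective_iff_bijective.1 (vertexMap_injective hd hc)
  set ρ : Equiv.Perm (Fin w.length) := Equiv.ofBijective _ hbij with hρ
  have hρpow : ∀ (m : ℕ) (k : Fin w.length), (ρ ^ m) k = (vertexMap w)^[m] k := fun m k => by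
    rw [Equiv.Perm.coe_pow]; rfl
  have hinj : Function.Injective w.get := nodup_iff_injective_get.1 hd
  intro k l
  -- `σ^i (w[k]) = w[l]` for some integer `i`; either sign gives `SameCycle ρ k l`
  have hkl : ρ.SameCycle k l := by
    obtain ⟨i, hi⟩ := h _ (get_mem w k) _ (get_mem w l)
    obtain ⟨m, rfl | rfl⟩ := Int.eq_nat_or_neg i
    · -- `σ^m (w[k]) = w[l]`, so `σ⁻ᵐ (w[l]) = w[k]`, i.e. `ρᵐ l = k`
      have e : (σ⁻¹ ^ m) (w.get l) = w.get k := by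
        rw [inv_pow, ← hi, zpow_natCast]
        exact Equiv.Perm.inv_eq_iff_eq.2 rfl
      rw [inv_pow_apply_get hd hc σ hσ] at e
      exact Equiv.Perm.SameCycle.symm ⟨m, by rw [zpow_natCast, hρpow]; exact hinj e⟩
    · -- `σ^{-m} (w[k]) = w[l]`, i.e. `ρᵐ k = l`
      have e : (σ⁻¹ ^ m) (w.get k) = w.get l := by rw [inv_pow, ← zpow_natCast, ← zpow_neg]; exact hi
      rw [inv_pow_apply_get hd hc σ hσ] at e
      exact ⟨m, by rw [zpow_natCast, hρpow]; exact hinj e⟩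
  obtain ⟨j, -, hj⟩ := hkl.exists_pow_eq'
  exact ⟨j, by rw [← hρpow, hj]⟩

/-- The same with the permutation `x ↦ w.formPerm x̄` itself spelled out through any involution-free
description: version taking the agreement on `w` only through the values `w.formPerm`.  (Convenience
restatement for face systems whose vertex permutation restricts to `x ↦ formPerm w x̄` on a face `w`
that is the whole system.) [cite: ZieschangVogtColdewey1980, 3.1.6] -/
theorem oneVertex_of_forall_sameCycle_formPerm (hd : w.Nodup) (hc : ∀ x ∈ w, (x.1, !x.2) ∈ w)
    (σ : Equiv.Perm (ι × Bool)) (hσ : ∀ x : ι × Bool, σ x = w.formPerm (x.1, !x.2))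
    (h : ∀ x ∈ w, ∀ y ∈ w, σ.SameCycle x y) : OneVertex w :=
  oneVertex_of_sameCycle hd hc σ (fun x _ => hσ x) h

end Literature.GroupTheory.CombinatorialGroupTheory
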